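import Literature.NumberTheory.LFunctions.Zhang2022.Section8DipoleTaylor
import Literature.NumberTheory.LFunctions.Zhang2022.KnifeEdgeLenZDegreeK0Short
import HarnessLib

/-!
# Zhang (2022) §8: the ψ-side row of `S_j` for PROFILE data — the inner sum `Σ_m 𝐚_u(tm)m^{β_j−1}` of Prop 7.1's `S_j`
# at a `C²` short piece is the dipole sum of the twisted shifted piece `V_t(z) = e^{(β_j log P)z}u(z_t + z)`, hence
# `= −χ(t)(L′(1,χ)/log P)(u′(z_t) + β_j log P·u(z_t)) + O(C_u𝓛⁻¹⁵)` for `tT ≤ P^θ` (LEMMA A at the shift `z_t`)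

Topic `Literature/NumberTheory/LFunctions/Zhang2022` (Landau–Siegel audit tree; verdict-neutral). Y. Zhang, *Discrete mean
estimates and the Landau–Siegel zero*, arXiv:2211.02515v1 (2022) [Zhang2022LandauSiegel] — **an unrefereed manuscript
under adjudication; nothing here asserts or denies its Theorems 1–2; no claim about Landau–Siegel zeros.** Cell
landau-siegel §D, crux K0 = stmt-Parity-20459 (row (S), `KnifeEdge.SjProfileRow`, p537807), prover ls-knife-K0-p1 g0.
This is Zhang's display after Lemma 8.4 («By Lemma 8.2 with `x = P₁/dr` … `Σ_m χ(m)ϰ₁(drm)/m^{1−β_j} =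
(L′(1,χ)/log P₁)𝔣_{j6}(P₁/dr) + O(𝓛⁻¹⁵)` if `dr < P₁/T`», p. 17; tree `Section8cStatements.Step8u040`) for a GENERAL `C²`
short piece `u` in place of `ϰ₁`: the `m`-sum of `Skeleton.Sj` at the profile table `KnifeEdge.profTable u` and outer index
`t = dr` is `χ(t)·Σ_{m ≤ P^θ/t} χ(m)m⁻¹V_t(z_m)` (`sjInner_psi_eq`) with `V_t = shiftTwist (β_jΛ) u z_t`, a `C²` piece on
`[0, θ − z_t]` vanishing at the end, so `DipoleRule.dipole_C2` evaluates it (`psiRow_C2`).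

## References
* Y. Zhang, arXiv:2211.02515v1 (2022), §8 Lemma 8.2 and the display after Lemma 8.4, p. 17; §7 Prop 7.1 (`S_j`), p. 13.
  [cite: Zhang2022LandauSiegel, §8 Lemma 8.2]
-/

noncomputable section

open Complex Real Finset MeasureTheory intervalIntegral Set

namespace Literature.NumberTheory.LFunctions.Zhang2022.DipoleRule

open Skeleton KnifeEdge

/-! ### The twisted shifted piece and its regularity -/

/-- **The twisted shifted piece** `V(z) = e^{γz}·u(z₀ + z)`. [cite: Zhang2022LandauSiegel, §8 Lemma 8.2] -/
def shiftTwist (γ : ℂ) (u : ℝ → ℂ) (z₀ z : ℝ) : ℂ := Complex.exp (γ * (z : ℂ)) * u (z₀ + z)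

/-- Its first derivative `V′(z) = e^{γz}(γu + u′)(z₀ + z)`. [cite: Zhang2022LandauSiegel, §8 Lemma 8.2] -/
def shiftTwist' (γ : ℂ) (u u' : ℝ → ℂ) (z₀ z : ℝ) : ℂ :=
  Complex.exp (γ * (z : ℂ)) * (γ * u (z₀ + z) + u' (z₀ + z))

/-- Its second derivative `V″(z) = e^{γz}(γ²u + 2γu′ + u″)(z₀ + z)`. [cite: Zhang2022LandauSiegel, §8 Lemma 8.2] -/
def shiftTwist'' (γ : ℂ) (u u' u'' : ℝ → ℂ) (z₀ z : ℝ) : ℂ :=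
  Complex.exp (γ * (z : ℂ)) * (γ ^ 2 * u (z₀ + z) + 2 * γ * u' (z₀ + z) + u'' (z₀ + z))

/-- `d/dz e^{γz} = γe^{γz}`. [folklore] -/
private theorem hasDerivAt_expMul (γ : ℂ) (z : ℝ) :
    HasDerivAt (fun z : ℝ => Complex.exp (γ * (z : ℂ))) (γ * Complex.exp (γ * (z : ℂ))) z := by
  have h0 : HasDerivAt (fun z : ℝ => (z : ℂ)) 1 z := by simpa using (hasDerivAt_id z).ofReal_comp
  have h2 := (h0.const_mul γ).cexp
  exact h2.congr_deriv (by ring)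

/-- `‖e^{γz}‖ = 1` for purely imaginary `γ`. [folklore] -/
private theorem norm_expMul_of_re_zero {γ : ℂ} (hγ : γ.re = 0) (z : ℝ) : ‖Complex.exp (γ * (z : ℂ))‖ = 1 := by
  rw [Complex.norm_exp]
  simp [Complex.mul_re, hγ]

/-- Translation carries a right derivative at `z₀ + z` to one at `z`. [folklore] -/
private theorem hasDerivWithinAt_shift {f : ℝ → ℂ} {f' : ℂ} {z₀ z : ℝ}
    (h : HasDerivWithinAt f f' (Ioi (z₀ + z)) (z₀ + z)) :
    HasDerivWithinAt (fun y : ℝ => f (z₀ + y)) f' (Ioi z) z := by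
  have hid : HasDerivWithinAt (fun y : ℝ => z₀ + y) 1 (Ioi z) z := (hasDerivAt_id z).const_add z₀ |>.hasDerivWithinAt
  have hmaps : MapsTo (fun y : ℝ => z₀ + y) (Ioi z) (Ioi (z₀ + z)) := fun y hy => by
    simp only [Set.mem_Ioi] at hy ⊢; linarith
  have := h.scomp_of_eq z hid hmaps rfl
  rw [one_smul] at this
  exact this

variable {γ : ℂ} {u u' u'' : ℝ → ℂ} {θ z₀ : ℝ}

/-- Continuity of `V` on `[0, θ − z₀]` from continuity of `u` on `[0,θ]` (`z₀ ≥ 0`). [cite: Zhang2022LandauSiegel, §8 Lemma 8.2] -/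
theorem continuousOn_shiftTwist (hu : ContinuousOn u (Icc 0 θ)) (hz₀ : 0 ≤ z₀) :
    ContinuousOn (shiftTwist γ u z₀) (Icc 0 (θ - z₀)) := by
  unfold shiftTwist
  refine (Complex.continuous_exp.comp (continuous_const.mul Complex.continuous_ofReal)).continuousOn.mul ?_
  refine hu.comp (continuous_const.add continuous_id).continuousOn fun z hz => ?_
  exact ⟨by linarith [hz.1], by linarith [hz.2]⟩

/-- Continuity of `V′` on `[0, θ − z₀]`. [cite: Zhang2022LandauSiegel, §8 Lemma 8.2] -/
theorem continuousOn_shiftTwist' (hu : ContinuousOn u (Icc 0 θ)) (hu' : ContinuousOn u' (Icc 0 θ)) (hz₀ : 0 ≤ z₀) :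
    ContinuousOn (shiftTwist' γ u u' z₀) (Icc 0 (θ - z₀)) := by
  unfold shiftTwist'
  have hmaps : MapsTo (fun z : ℝ => z₀ + z) (Icc 0 (θ - z₀)) (Icc 0 θ) := fun z hz =>
    ⟨by linarith [hz.1], by linarith [hz.2]⟩
  refine (Complex.continuous_exp.comp (continuous_const.mul Complex.continuous_ofReal)).continuousOn.mul ?_
  exact (continuousOn_const.mul (hu.comp (continuous_const.add continuous_id).continuousOn hmaps)).add
    (hu'.comp (continuous_const.add continuous_id).continuousOn hmaps)

/-- Continuity of `V″` on `[0, θ − z₀]`. [cite: Zhang2022LandauSiegel, §8 Lemma 8.2] -/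
theorem continuousOn_shiftTwist'' (hu : ContinuousOn u (Icc 0 θ)) (hu' : ContinuousOn u' (Icc 0 θ))
    (hu'' : ContinuousOn u'' (Icc 0 θ)) (hz₀ : 0 ≤ z₀) :
    ContinuousOn (shiftTwist'' γ u u' u'' z₀) (Icc 0 (θ - z₀)) := by
  unfold shiftTwist''
  have hmaps : MapsTo (fun z : ℝ => z₀ + z) (Icc 0 (θ - z₀)) (Icc 0 θ) := fun z hz =>
    ⟨by linarith [hz.1], by linarith [hz.2]⟩
  have hc : Continuous fun z : ℝ => z₀ + z := continuous_const.add continuous_id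
  refine (Complex.continuous_exp.comp (continuous_const.mul Complex.continuous_ofReal)).continuousOn.mul ?_
  exact ((continuousOn_const.mul (hu.comp hc.continuousOn hmaps)).add
    (continuousOn_const.mul (hu'.comp hc.continuousOn hmaps))).add (hu''.comp hc.continuousOn hmaps)

/-- Right derivative of `V` inside `(0, θ − z₀)`. [cite: Zhang2022LandauSiegel, §8 Lemma 8.2] -/
theorem hasDeriv_shiftTwist (hd : ∀ y ∈ Ioo 0 θ, HasDerivWithinAt u (u' y) (Ioi y) y) (hz₀ : 0 ≤ z₀)
    {z : ℝ} (hz : z ∈ Ioo 0 (θ - z₀)) :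
    HasDerivWithinAt (shiftTwist γ u z₀) (shiftTwist' γ u u' z₀ z) (Ioi z) z := by
  have hy : z₀ + z ∈ Ioo 0 θ := ⟨by linarith [hz.1], by linarith [hz.2]⟩
  have h1 := (hasDerivAt_expMul γ z).hasDerivWithinAt (s := Ioi z)
  have h2 := hasDerivWithinAt_shift (hd (z₀ + z) hy)
  have h : HasDerivWithinAt (fun y : ℝ => Complex.exp (γ * (y : ℂ)) * u (z₀ + y))
      (γ * Complex.exp (γ * (z : ℂ)) * u (z₀ + z) + Complex.exp (γ * (z : ℂ)) * u' (z₀ + z)) (Ioi z) z := h1.mul h2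
  unfold shiftTwist shiftTwist'
  exact h.congr_deriv (by ring)

/-- Right derivative of `V′` inside `(0, θ − z₀)`. [cite: Zhang2022LandauSiegel, §8 Lemma 8.2] -/
theorem hasDeriv_shiftTwist' (hd : ∀ y ∈ Ioo 0 θ, HasDerivWithinAt u (u' y) (Ioi y) y)
    (hd' : ∀ y ∈ Ioo 0 θ, HasDerivWithinAt u' (u'' y) (Ioi y) y) (hz₀ : 0 ≤ z₀)
    {z : ℝ} (hz : z ∈ Ioo 0 (θ - z₀)) :
    HasDerivWithinAt (shiftTwist' γ u u' z₀) (shiftTwist'' γ u u' u'' z₀ z) (Ioi z) z := by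
  have hy : z₀ + z ∈ Ioo 0 θ := ⟨by linarith [hz.1], by linarith [hz.2]⟩
  have h1 := (hasDerivAt_expMul γ z).hasDerivWithinAt (s := Ioi z)
  have h2 := hasDerivWithinAt_shift (hd (z₀ + z) hy)
  have h3 := hasDerivWithinAt_shift (hd' (z₀ + z) hy)
  have h : HasDerivWithinAt (fun y : ℝ => Complex.exp (γ * (y : ℂ)) * (γ * u (z₀ + y) + u' (z₀ + y)))
      (γ * Complex.exp (γ * (z : ℂ)) * (γ * u (z₀ + z) + u' (z₀ + z))
        + Complex.exp (γ * (z : ℂ)) * (γ * u' (z₀ + z) + u'' (z₀ + z))) (Ioi z) z := h1.mul ((h2.const_mul γ).add h3)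
  unfold shiftTwist' shiftTwist''
  exact h.congr_deriv (by ring)

/-- Pointwise bound `‖V″(z)‖ ≤ ‖γ‖²B₀ + 2‖γ‖B₁ + B₂` for purely imaginary `γ` and `‖u‖ ≤ B₀`, `‖u′‖ ≤ B₁`, `‖u″‖ ≤ B₂` at
`z₀ + z`. [cite: Zhang2022LandauSiegel, §8 Lemma 8.2] -/
theorem norm_shiftTwist''_le (hγ : γ.re = 0) {z : ℝ} {B₀ B₁ B₂ : ℝ} (h0 : ‖u (z₀ + z)‖ ≤ B₀)
    (h1 : ‖u' (z₀ + z)‖ ≤ B₁) (h2 : ‖u'' (z₀ + z)‖ ≤ B₂) :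
    ‖shiftTwist'' γ u u' u'' z₀ z‖ ≤ ‖γ‖ ^ 2 * B₀ + 2 * ‖γ‖ * B₁ + B₂ := by
  unfold shiftTwist''
  rw [norm_mul, norm_expMul_of_re_zero hγ, one_mul]
  calc ‖γ ^ 2 * u (z₀ + z) + 2 * γ * u' (z₀ + z) + u'' (z₀ + z)‖
      ≤ ‖γ ^ 2 * u (z₀ + z)‖ + ‖2 * γ * u' (z₀ + z)‖ + ‖u'' (z₀ + z)‖ := norm_add₃_le
    _ ≤ ‖γ‖ ^ 2 * B₀ + 2 * ‖γ‖ * B₁ + B₂ := by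
        rw [norm_mul, norm_mul, norm_pow, norm_mul, Complex.norm_two]
        gcongr

/-! ### The dipole estimate for the twisted shifted piece -/

/-- **LEMMA A at the shift `z₀` (C² short piece):** `χ` primitive mod `D`, `𝓛 ≥ 3`, `‖L(1,χ)‖ ≤ 𝓛⁻²⁰²²`; `u, u′, u″`
continuous on `[0,θ]` with right derivatives `u′, u″` inside, `u(θ) = 0`, `θ ≤ 1`; bounds `‖u‖ ≤ B₀`, `‖u′‖ ≤ B₁`,
`‖u″‖ ≤ B₂` on `[0,θ]`; `γ` purely imaginary; shift `0 ≤ z₀` with `τ ≤ θ − z₀` (`τ = 𝓛^{1.1}/𝓛⁹`). Then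
`‖Σ_{m≤e^{(θ−z₀)𝓛⁹}} χ(m)m⁻¹V(z_m) + (𝓛⁹)⁻¹L′(1,χ)(γu(z₀) + u′(z₀))‖ ≤ (𝓛⁹)⁻¹·[C₈₂(0)𝓛⁻⁶((‖γ‖B₀+B₁) + (‖γ‖²B₀+2‖γ‖B₁+B₂)·1)
+ τ(‖γ‖²B₀+2‖γ‖B₁+B₂)(2𝓛^{2.2} + ‖L′(1,χ)‖)]`. [cite: Zhang2022LandauSiegel, §8 Lemma 8.2] -/
theorem dipole_shiftTwist {D : ℕ} [NeZero D] (χ : DirichletCharacter ℂ D) (hprim : χ.IsPrimitive)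
    (hL : 3 ≤ Real.log D) (hA : ‖χ.LFunction 1‖ ≤ 1 / Real.log D ^ 2022) (hγ : γ.re = 0)
    (hθ1 : θ ≤ 1) (hz₀ : 0 ≤ z₀) (hτ : Real.log D ^ (11 / 10 : ℝ) / Real.log D ^ 9 ≤ θ - z₀)
    (hu : ContinuousOn u (Icc 0 θ)) (hu' : ContinuousOn u' (Icc 0 θ)) (hu'' : ContinuousOn u'' (Icc 0 θ))
    (hd : ∀ y ∈ Ioo 0 θ, HasDerivWithinAt u (u' y) (Ioi y) y)
    (hd' : ∀ y ∈ Ioo 0 θ, HasDerivWithinAt u' (u'' y) (Ioi y) y) (huθ : u θ = 0)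
    {B₀ B₁ B₂ : ℝ} (hB0 : ∀ y ∈ Icc 0 θ, ‖u y‖ ≤ B₀) (hB1 : ∀ y ∈ Icc 0 θ, ‖u' y‖ ≤ B₁)
    (hB2 : ∀ y ∈ Icc 0 θ, ‖u'' y‖ ≤ B₂) :
    ‖(∑ m ∈ Finset.Ioc 0 ⌊Real.exp ((θ - z₀) * Real.log D ^ 9)⌋₊,
        χ (m : ZMod D) * (m : ℂ)⁻¹ * shiftTwist γ u z₀ (Real.log m / Real.log D ^ 9))
        + ((Real.log D ^ 9 : ℝ) : ℂ)⁻¹ * deriv χ.LFunction 1 * (γ * u z₀ + u' z₀)‖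
      ≤ (Real.log D ^ 9)⁻¹ *
        (Lemma82.C82 0 / Real.log D ^ 6 *
            ((‖γ‖ * B₀ + B₁) + (‖γ‖ ^ 2 * B₀ + 2 * ‖γ‖ * B₁ + B₂) * (θ - z₀))
          + Real.log D ^ (11 / 10 : ℝ) / Real.log D ^ 9 * (‖γ‖ ^ 2 * B₀ + 2 * ‖γ‖ * B₁ + B₂) *
            (2 * Real.log D ^ (22 / 10 : ℝ) + ‖deriv χ.LFunction 1‖)) := by
  set Z : ℝ := θ - z₀ with hZ
  set S : ℝ := ‖γ‖ ^ 2 * B₀ + 2 * ‖γ‖ * B₁ + B₂ with hS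
  have hℓ0 : 0 < Real.log D := by linarith
  have hτ0 : 0 < Real.log D ^ (11 / 10 : ℝ) / Real.log D ^ 9 := by positivity
  have hZ0 : 0 < Z := lt_of_lt_of_le hτ0 hτ
  have hmaps : ∀ z ∈ Icc 0 Z, z₀ + z ∈ Icc 0 θ := fun z hz => ⟨by linarith [hz.1], by linarith [hz.2, hZ]⟩
  -- the data of `dipole_C2` for `V`
  have hV := continuousOn_shiftTwist (γ := γ) hu hz₀
  have hV' := continuousOn_shiftTwist' (γ := γ) hu hu' hz₀
  have hV'' := continuousOn_shiftTwist'' (γ := γ) hu hu' hu'' hz₀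
  have hVd : ∀ z ∈ Ioo 0 Z, HasDerivWithinAt (shiftTwist γ u z₀) (shiftTwist' γ u u' z₀ z) (Ioi z) z :=
    fun z hz => hasDeriv_shiftTwist hd hz₀ hz
  have hVd' : ∀ z ∈ Ioo 0 Z, HasDerivWithinAt (shiftTwist' γ u u' z₀) (shiftTwist'' γ u u' u'' z₀ z) (Ioi z) z :=
    fun z hz => hasDeriv_shiftTwist' hd hd' hz₀ hz
  have hVint : IntervalIntegrable (shiftTwist'' γ u u' u'' z₀) volume 0 Z :=
    ContinuousOn.intervalIntegrable (by rw [Set.uIcc_of_le hZ0.le]; exact hV'')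
  have hVZ : shiftTwist γ u z₀ Z = 0 := by simp [shiftTwist, hZ, huθ]
  have hSb : ∀ y ∈ Icc (0 : ℝ) (Real.log D ^ (11 / 10 : ℝ) / Real.log D ^ 9), ‖shiftTwist'' γ u u' u'' z₀ y‖ ≤ S := by
    intro y hy
    have hy' : z₀ + y ∈ Icc 0 θ := hmaps y ⟨hy.1, hy.2.trans hτ⟩
    exact norm_shiftTwist''_le hγ (hB0 _ hy') (hB1 _ hy') (hB2 _ hy')
  -- apply `dipole_C2`
  have key := dipole_C2 χ hprim hL hA (u := shiftTwist γ u z₀) (u' := shiftTwist' γ u u' z₀)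
    (u'' := shiftTwist'' γ u u' u'' z₀) (Z := Z) (S := S) (by linarith) hτ hV hV' hVd hVd' hVint hVZ hSb
  -- `V′(0) = γu(z₀) + u′(z₀)`
  have hV0 : shiftTwist' γ u u' z₀ 0 = γ * u z₀ + u' z₀ := by simp [shiftTwist']
  rw [hV0] at key
  refine key.trans ?_
  -- bound the norms inside
  have hVZ' : ‖shiftTwist' γ u u' z₀ Z‖ ≤ ‖γ‖ * B₀ + B₁ := by
    unfold shiftTwist'
    rw [norm_mul, norm_expMul_of_re_zero hγ, one_mul]
    have hθ' : z₀ + Z ∈ Icc 0 θ := hmaps Z ⟨hZ0.le, le_rfl⟩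
    calc ‖γ * u (z₀ + Z) + u' (z₀ + Z)‖ ≤ ‖γ * u (z₀ + Z)‖ + ‖u' (z₀ + Z)‖ := norm_add_le _ _
      _ ≤ ‖γ‖ * B₀ + B₁ := by rw [norm_mul]; gcongr; exacts [hB0 _ hθ', hB1 _ hθ']
  have hint : (∫ y in (0:ℝ)..Z, ‖shiftTwist'' γ u u' u'' z₀ y‖) ≤ S * (θ - z₀) := by
    have h1 : (∫ y in (0:ℝ)..Z, ‖shiftTwist'' γ u u' u'' z₀ y‖) ≤ ∫ y in (0:ℝ)..Z, S := by
      refine intervalIntegral.integral_mono_on hZ0.le ?_ ?_ fun y hy => ?_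
      · exact (ContinuousOn.intervalIntegrable (by rw [Set.uIcc_of_le hZ0.le]; exact hV''.norm))
      · exact intervalIntegrable_const
      · exact norm_shiftTwist''_le hγ (hB0 _ (hmaps y hy)) (hB1 _ (hmaps y hy)) (hB2 _ (hmaps y hy))
    rw [intervalIntegral.integral_const, smul_eq_mul, sub_zero] at h1
    linarith [h1]
  have hC0 : 0 ≤ Lemma82.C82 0 / Real.log D ^ 6 := by
    unfold Lemma82.C82
    have : 0 ≤ Lemma82.I0 := Lemma82.I0_nonneg
    positivity
  have hℓ9 : 0 ≤ (Real.log D ^ 9)⁻¹ := by positivity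
  refine mul_le_mul_of_nonneg_left ?_ hℓ9
  refine add_le_add (mul_le_mul_of_nonneg_left (add_le_add hVZ' hint) hC0) le_rfl

/-! ### The `m`-sum of `S_j` at the profile table is the dipole sum of the twisted shifted piece -/

/-- `1/m^{1−β} = m⁻¹·e^{β log m}` for `m ≥ 1`. [folklore] -/
private theorem inv_cpow_one_sub {m : ℕ} (hm : 1 ≤ m) (β : ℂ) :
    ((m : ℂ) ^ (1 - β))⁻¹ = (m : ℂ)⁻¹ * Complex.exp (β * (Real.log m : ℂ)) := by
  have hm0 : (m : ℂ) ≠ 0 := by exact_mod_cast (by omega : m ≠ 0)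
  have hmR : (0 : ℝ) ≤ m := by positivity
  rw [sub_eq_add_neg, Complex.cpow_add _ _ hm0, Complex.cpow_one, Complex.cpow_def_of_ne_zero hm0,
    ← Complex.ofReal_natCast, ← Complex.ofReal_log hmR, mul_inv, ← Complex.exp_neg]
  congr 1
  ring_nf

/-- `e^{(θ − log t/Λ)Λ} = e^{θΛ}/t` (`t ≥ 1`, `Λ ≠ 0`). [folklore] -/
private theorem exp_shift_eq {θ Λ : ℝ} (hΛ : Λ ≠ 0) {t : ℕ} (ht : 1 ≤ t) :
    Real.exp ((θ - Real.log t / Λ) * Λ) = Real.exp (θ * Λ) / t := by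
  have ht0 : (0 : ℝ) < t := by exact_mod_cast ht
  rw [sub_mul, div_mul_cancel₀ _ hΛ, Real.exp_sub, Real.exp_log ht0]

/-- **The `m`-sum of Prop 7.1's `S_j` at the profile table of a short piece, outer index `t = dr`:**
`Σ_{1≤m<⌈PT⁻²⌉} 𝐚_u(tm)·m^{β_j−1} = χ(t)·Σ_{m ≤ P^θ/t} χ(m)m⁻¹V_t(z_m)` with `V_t = shiftTwist (β_jΛ) u z_t`,
`z_t = log t/Λ`, `Λ = 𝓛⁹` — for `u = 0` on `[θ,∞)` and `P^θ < ⌈PT⁻²⌉` (large `D`, `θ < 1`). [cite: Zhang2022LandauSiegel, §7 Prop 7.1; §8 display after Lemma 8.4] -/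
theorem sjInner_psi_eq {D : ℕ} (χ : DirichletCharacter ℂ D) (c' : ℝ) (j : ℕ) {u : ℝ → ℂ} {θ : ℝ}
    (hvan : ∀ y : ℝ, θ ≤ y → u y = 0) (hℓ : 0 < Real.log D) {t : ℕ} (ht : 1 ≤ t)
    (hθN : Real.exp (θ * Real.log D ^ 9) < Nsupp D) :
    ∑ m ∈ Finset.Ico 1 (Nsupp D), profTable u D χ (t * m) / (m : ℂ) ^ (1 - betaJ c' D j)
      = χ (t : ZMod D) * ∑ m ∈ Finset.Ioc 0 ⌊Real.exp ((θ - Real.log t / Real.log D ^ 9) * Real.log D ^ 9)⌋₊,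
          χ (m : ZMod D) * (m : ℂ)⁻¹ *
            shiftTwist (betaJ c' D j * Real.log D ^ 9) u (Real.log t / Real.log D ^ 9)
              (Real.log m / Real.log D ^ 9) := by
  set Λ : ℝ := Real.log D ^ 9 with hΛ
  set β : ℂ := betaJ c' D j with hβ
  have hΛ0 : 0 < Λ := by positivity
  have ht0 : (0 : ℝ) < t := by exact_mod_cast ht
  have hlogP : Real.log (bigP D) = Λ := by rw [bigP, Real.log_exp]; rfl
  rw [exp_shift_eq hΛ0.ne' ht]
  set N : ℕ := ⌊Real.exp (θ * Λ) / t⌋₊ with hN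
  -- `N < Nsupp`
  have hNlt : N < Nsupp D := by
    have h1 : Real.exp (θ * Λ) / t ≤ Real.exp (θ * Λ) := div_le_self (Real.exp_pos _).le (by exact_mod_cast ht)
    have h2 : (N : ℝ) ≤ Real.exp (θ * Λ) / t := Nat.floor_le (by positivity)
    exact_mod_cast lt_of_le_of_lt (h2.trans h1) hθN
  -- split the `m`-range at `N + 1`
  rw [← Finset.sum_Ico_consecutive _ (by omega : 1 ≤ N + 1) (by omega : N + 1 ≤ Nsupp D)]
  have htail : ∑ m ∈ Finset.Ico (N + 1) (Nsupp D), profTable u D χ (t * m) / (m : ℂ) ^ (1 - β) = 0 := by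
    refine Finset.sum_eq_zero fun m hm => ?_
    rw [Finset.mem_Ico] at hm
    have hmgt : Real.exp (θ * Λ) / t < m := by
      have := Nat.lt_of_floor_lt (show N < m by omega)
      exact this
    have hm0 : (0 : ℝ) < m := lt_of_le_of_lt (by positivity) hmgt
    have htm : Real.exp (θ * Λ) < (t : ℝ) * m := by rwa [div_lt_iff₀' ht0] at hmgt
    have hz : θ ≤ Real.log ((t * m : ℕ) : ℝ) / Real.log (bigP D) := by
      rw [hlogP, le_div_iff₀ hΛ0, ← Real.log_exp (θ * Λ)]
      push_cast
      exact Real.log_le_log (Real.exp_pos _) htm.le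
    unfold profTable
    split_ifs with hg
    · rw [hvan _ hz, mul_zero, zero_div]
    · rw [zero_div]
  rw [htail, add_zero, Finset.mul_sum]
  have hIcc : Finset.Ico 1 (N + 1) = Finset.Ioc 0 N := by
    ext m; simp only [Finset.mem_Ico, Finset.mem_Ioc]; omega
  rw [hIcc]
  refine Finset.sum_congr rfl fun m hm => ?_
  rw [Finset.mem_Ioc] at hm
  have hm1 : 1 ≤ m := hm.1
  have hm0 : (0 : ℝ) < m := by exact_mod_cast hm1
  -- the guard holds: `tm ≤ e^{θΛ} < Nsupp`
  have htm : t * m < Nsupp D := by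
    have h1 : (m : ℝ) ≤ Real.exp (θ * Λ) / t := le_trans (by exact_mod_cast hm.2) (Nat.floor_le (by positivity))
    have h2 : (t : ℝ) * m ≤ Real.exp (θ * Λ) := by rwa [le_div_iff₀' ht0] at h1
    exact_mod_cast lt_of_le_of_lt h2 hθN
  unfold profTable shiftTwist
  rw [if_pos htm, div_eq_mul_inv, inv_cpow_one_sub hm1 β]
  have hlog : Real.log ((t * m : ℕ) : ℝ) / Real.log (bigP D) = Real.log t / Λ + Real.log m / Λ := by
    push_cast
    rw [Real.log_mul ht0.ne' hm0.ne', hlogP, add_div]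
  rw [hlog]
  have hχ : χ ((t * m : ℕ) : ZMod D) = χ (t : ZMod D) * χ (m : ZMod D) := by
    rw [Nat.cast_mul, map_mul]
  rw [hχ]
  have hΛC : (Λ : ℂ) ≠ 0 := by exact_mod_cast hΛ0.ne'
  have hexp : Complex.exp (β * (Real.log m : ℂ))
      = Complex.exp (β * ((Real.log m / Λ : ℝ) : ℂ) * ((Real.log D : ℝ) : ℂ) ^ 9) := by
    congr 1
    have : ((Real.log D : ℝ) : ℂ) ^ 9 = (Λ : ℂ) := by rw [hΛ]; push_cast; ring
    rw [this]
    push_cast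
    field_simp
  rw [hexp]
  ring

/-! ### The ψ-side row for a `C²` short piece -/

/-- `Re β_j = 0`: the shifts (2.13) are purely imaginary. [cite: Zhang2022LandauSiegel, §2 (2.13)] -/
private theorem betaJ_re (c' : ℝ) (D : ℕ) (j : ℕ) : (betaJ c' D j).re = 0 := by
  unfold betaJ beta1 beta2 beta3
  split_ifs <;> simp

/-- **THE ψ-SIDE ROW OF `S_j` FOR A `C²` SHORT PIECE (fixed modulus, under (A)) — Zhang's display after Lemma 8.4 for a
general profile:** `χ` primitive mod `D`, `𝓛 ≥ 3`, `‖L(1,χ)‖ ≤ 𝓛⁻²⁰²²`; `u, u′, u″` continuous on `[0,θ]` with right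
derivatives inside, `u = 0` on `[θ,∞)`, `θ ≤ 1`, bounds `B₀, B₁, B₂`; `t ≥ 1` with `τ ≤ θ − z_t` (`tT ≤ P^θ`) and `P^θ < ⌈PT⁻²⌉`.
Then, with `Λ = 𝓛⁹`, `γ = β_jΛ`, `z_t = log t/Λ`:
`‖Σ_{1≤m<⌈PT⁻²⌉} 𝐚_u(tm)m^{β_j−1} + χ(t)·Λ⁻¹L′(1,χ)·(γu(z_t) + u′(z_t))‖ ≤ Λ⁻¹·[C₈₂(0)𝓛⁻⁶((‖γ‖B₀+B₁) +
(‖γ‖²B₀+2‖γ‖B₁+B₂)(θ − z_t)) + τ(‖γ‖²B₀+2‖γ‖B₁+B₂)(2𝓛^{2.2} + ‖L′‖)]` — the main term is `−χ(t)(L′/log P)·𝔧_j(u;z_t)` up to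
`γ = β_j log P = iπb_j(1 + O(α𝓛))`. [cite: Zhang2022LandauSiegel, §8 Lemma 8.2 and display after Lemma 8.4] -/
theorem psiRow_C2 {D : ℕ} [NeZero D] (χ : DirichletCharacter ℂ D) (c' : ℝ) (j : ℕ) (hprim : χ.IsPrimitive)
    (hL : 3 ≤ Real.log D) (hA : ‖χ.LFunction 1‖ ≤ 1 / Real.log D ^ 2022) {u u' u'' : ℝ → ℂ} {θ : ℝ}
    (hθ1 : θ ≤ 1) (hu : ContinuousOn u (Icc 0 θ)) (hu' : ContinuousOn u' (Icc 0 θ)) (hu'' : ContinuousOn u'' (Icc 0 θ))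
    (hd : ∀ y ∈ Ioo 0 θ, HasDerivWithinAt u (u' y) (Ioi y) y)
    (hd' : ∀ y ∈ Ioo 0 θ, HasDerivWithinAt u' (u'' y) (Ioi y) y) (hvan : ∀ y : ℝ, θ ≤ y → u y = 0)
    {B₀ B₁ B₂ : ℝ} (hB0 : ∀ y ∈ Icc 0 θ, ‖u y‖ ≤ B₀) (hB1 : ∀ y ∈ Icc 0 θ, ‖u' y‖ ≤ B₁)
    (hB2 : ∀ y ∈ Icc 0 θ, ‖u'' y‖ ≤ B₂) {t : ℕ} (ht : 1 ≤ t)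
    (htT : Real.log D ^ (11 / 10 : ℝ) / Real.log D ^ 9 ≤ θ - Real.log t / Real.log D ^ 9)
    (hθN : Real.exp (θ * Real.log D ^ 9) < Nsupp D) :
    ‖(∑ m ∈ Finset.Ico 1 (Nsupp D), profTable u D χ (t * m) / (m : ℂ) ^ (1 - betaJ c' D j))
        + χ (t : ZMod D) * (((Real.log D ^ 9 : ℝ) : ℂ)⁻¹ * deriv χ.LFunction 1 *
            (betaJ c' D j * Real.log D ^ 9 * u (Real.log t / Real.log D ^ 9) + u' (Real.log t / Real.log D ^ 9)))‖
      ≤ (Real.log D ^ 9)⁻¹ *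
        (Lemma82.C82 0 / Real.log D ^ 6 *
            ((‖betaJ c' D j * Real.log D ^ 9‖ * B₀ + B₁)
              + (‖betaJ c' D j * Real.log D ^ 9‖ ^ 2 * B₀ + 2 * ‖betaJ c' D j * Real.log D ^ 9‖ * B₁ + B₂)
                * (θ - Real.log t / Real.log D ^ 9))
          + Real.log D ^ (11 / 10 : ℝ) / Real.log D ^ 9
            * (‖betaJ c' D j * Real.log D ^ 9‖ ^ 2 * B₀ + 2 * ‖betaJ c' D j * Real.log D ^ 9‖ * B₁ + B₂)
            * (2 * Real.log D ^ (22 / 10 : ℝ) + ‖deriv χ.LFunction 1‖)) := by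
  have hℓ : 0 < Real.log D := by linarith
  have ht0 : (0 : ℝ) < t := by exact_mod_cast ht
  have hz₀ : 0 ≤ Real.log t / Real.log D ^ 9 := div_nonneg (Real.log_nonneg (by exact_mod_cast ht)) (by positivity)
  have hγ : (betaJ c' D j * Real.log D ^ 9 : ℂ).re = 0 := by
    rw [show (betaJ c' D j * Real.log D ^ 9 : ℂ) = betaJ c' D j * ((Real.log D ^ 9 : ℝ) : ℂ) by push_cast; ring,
      Complex.mul_re, betaJ_re, Complex.ofReal_im]
    ring
  have huθ : u θ = 0 := hvan θ le_rfl
  rw [sjInner_psi_eq χ c' j hvan hℓ ht hθN, ← mul_add, norm_mul]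
  have hχ1 : ‖χ (t : ZMod D)‖ ≤ 1 := χ.norm_le_one _
  have key := dipole_shiftTwist (γ := betaJ c' D j * Real.log D ^ 9) (z₀ := Real.log t / Real.log D ^ 9) χ hprim hL hA
    hγ hθ1 hz₀ htT hu hu' hu'' hd hd' huθ hB0 hB1 hB2
  calc ‖χ (t : ZMod D)‖ * _ ≤ 1 * _ := mul_le_mul_of_nonneg_right hχ1 (norm_nonneg _)
    _ ≤ _ := by rw [one_mul]; exact key

end Literature.NumberTheory.LFunctions.Zhang2022.DipoleRule

end
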